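import Mathlib
import HarnessLib
import Summits.ResolutionOfSingularities.ResolutionOfSingularities.Theorems.WildQuotientsWildQuotientResolutionS1aQhRoot

/-!
# S1a — THE QUASI-HOMOGENEOUS ROOT (R4 normal form), chart level: the FREE MODEL `k[x_none, x′][1/H]` of the node of ANY producer chart, with all pins

[OURS · L1 W4.5c · lead-1 g16; R4a brick 3b (after ✓`…S1aQhRoot`); pattern ✓`…S1aSymChartModel` / ✓`…S1aSymTail` (model level), for GENERAL weights `w`
(`w 0 = w 1 + sh`), the invariant second generator and a general tail `t ∈ 𝒥_sh`; pinned root model from ✓`FreeModel.exists_rootModelEquiv_X` with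
`W = (w 0, w 1, w 2, 0)`] — NOT statements of the manuscript; counted 0; AI-level work, weaker than expert review. Crux stmt-ResolutionOfSingularities-17941
`CyclicQuotientFourfolds`, line `s1a-logminvertex` v13 (`stub_reachLowerInFX`).
* `exists_qhRootModel` (pinned root model `Ψ : R^w ≃ k[x_none, x′₀..x′₃]`, `Ψ(e⁻¹a) = subst_W a`, `Ψ s = x_none`, `Ψ uᵢ′ = x′ᵢ`), `qh_model_X`, `qh_model_tail_pin` / `qh_model_tail_eq`
  (`x_none^sh · Ψ t̂ = subst t`);
* `qh_sigmaP_fixed` / `qh_sigmaP_X_some_one` / `qh_sigmaP_X_some_three` (`σ_P = conj Ψ σ_R`: `x_none, x′₀, x′₂`, constants fixed; `x′₁ ↦ x′₁ + x_none^sh x′₀`; `x₃ ↦ x₃ + x_none^sh · Ψ t̂`);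
* on `Φ : ChartRing_y ≃ k[x_none, x′][1/Ψ(yT^{dbar})]`: ROWS `qh_model_row_*` (`x₃ ↦ x₃ + x_none^sh T′` for `subst t = x_none^sh T′`), `qh_model_rows_fixed` (`x_none, x′₀, x′₂, H⁻¹`, constants), DEGREES
  `qh_model_degree_*` relative to `θ = consIndexEquiv mo (1,0)` (`x′ᵢ : (w i)•θ`, `x₃ : 0`, constants `0`, `Ψ t̂ : sh•θ`, `x_none : −θ`, `H⁻¹ : −dbar•θ`), PIN `qh_model_residual_zero`.
-/

set_option linter.dupNamespace false

noncomputable section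

open Literature.AlgebraicGeometry.Resolution
open scoped LaurentPolynomial
open MvPolynomial
open Summit.ResolutionOfSingularities.ResolutionOfSingularities.Theorems.WildQuotientResolution.S1
open Summit.ResolutionOfSingularities.ResolutionOfSingularities.Theorems.WildQuotientResolution.S1.CoarseChart
open Summit.ResolutionOfSingularities.ResolutionOfSingularities.Theorems.WildQuotientResolution.S1.ProducerStep
open Summit.ResolutionOfSingularities.ResolutionOfSingularities.Theorems.WildQuotientResolution.S1.ReesBigrading
open Summit.ResolutionOfSingularities.ResolutionOfSingularities.Theorems.WildQuotientResolution.S1.NodeTransport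
open Summit.ResolutionOfSingularities.ResolutionOfSingularities.Theorems.WildQuotientResolution.S1.CobordantTransport
open Summit.ResolutionOfSingularities.ResolutionOfSingularities.Theorems.WildQuotientResolution.S1.BlowupCharts
open Summit.ResolutionOfSingularities.ResolutionOfSingularities.Theorems.WildQuotientResolution.S1.FreeModel

namespace Summit.ResolutionOfSingularities.ResolutionOfSingularities.Theorems.WildQuotientResolution.S1.KillCert.Qh

variable {k : Type} [Field k] {A : Type} [CommRing A]
  (σ : MvPolynomial (Fin 4) k ≃+* MvPolynomial (Fin 4) k) (hC : ∀ a : k, σ (C a) = C a)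
  (h0 : σ (X 0) = X 0) (h1 : σ (X 1) = X 1 + X 0) (h2 : σ (X 2) = X 2) (w : Fin 3 → ℕ) (sh : ℕ) (t : MvPolynomial (Fin 4) k)
  (h3 : σ (X 3) = X 3 + t)
  (e : A ≃+* MvPolynomial (Fin 4) k) (τ : A ≃+* A) (hact : ∀ x : A, τ x = e.symm (σ (e x)))
  (hw0 : w 0 = w 1 + sh)
  (ht : e.symm t ∈ (weightedFiltration (e.symm ∘ ![X 0, X 1, X 2] : Fin 3 → A) w).ideal sh)
  {p : ℕ} (hp : 0 < p) (hσp : ∀ x : A, (⇑τ)^[p] x = x)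
  (hσJ : ∀ n : ℕ, ((weightedFiltration (e.symm ∘ ![X 0, X 1, X 2] : Fin 3 → A) w).ideal n).map (τ : A →+* A) ≤
    (weightedFiltration (e.symm ∘ ![X 0, X 1, X 2] : Fin 3 → A) w).ideal n)
  (Ψ : ↥(cobordantAlgebra (e.symm ∘ ![X 0, X 1, X 2] : Fin 3 → A) w) ≃+* MvPolynomial (Option (Fin 4)) k)
  (hΨa : ∀ a : MvPolynomial (Fin 4) k, Ψ (algebraMap A _ (e.symm a)) = cobordantAlgebra.subst k (![w 0, w 1, w 2, 0] : Fin 4 → ℕ) a)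
  (hΨs : Ψ (cobordantAlgebra.s _ _) = X none)
  (hΨu : ∀ i : Fin 3, Ψ (cobordantAlgebra.u' (e.symm ∘ ![X 0, X 1, X 2] : Fin 3 → A) w i) = X (some (Fin.castSucc i)))

/-! ## The pinned root model and `σ_P = conj Ψ σ_R` on its generators -/

/-- ★ **A pinned root model for the quasi-homogeneous centre exists** (✓`FreeModel.exists_rootModelEquiv_X` for `v = (0, 1, 2)`, `W = (w 0, w 1, w 2, 0)`). -/
theorem exists_qhRootModel :
    ∃ Ψ : ↥(cobordantAlgebra (e.symm ∘ ![X 0, X 1, X 2] : Fin 3 → A) w) ≃+* MvPolynomial (Option (Fin 4)) k,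
      (∀ a : MvPolynomial (Fin 4) k, Ψ (algebraMap A _ (e.symm a)) = cobordantAlgebra.subst k (![w 0, w 1, w 2, 0] : Fin 4 → ℕ) a) ∧
      Ψ (cobordantAlgebra.s _ _) = X none ∧
      ∀ i : Fin 3, Ψ (cobordantAlgebra.u' (e.symm ∘ ![X 0, X 1, X 2] : Fin 3 → A) w i) = X (some (Fin.castSucc i)) := by
  have hfam : (e.symm ∘ ![X 0, X 1, X 2] : Fin 3 → A) = ⇑e.symm ∘ ((X : Fin 4 → MvPolynomial (Fin 4) k) ∘ ![0, 1, 2]) := by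
    funext i; fin_cases i <;> rfl
  have hvW : ∀ i, (![w 0, w 1, w 2, 0] : Fin 4 → ℕ) ((![0, 1, 2] : Fin 3 → Fin 4) i) = w i := fun i => by
    fin_cases i <;> rfl
  have hW : ∀ l, (![w 0, w 1, w 2, 0] : Fin 4 → ℕ) l = 0 ∨ ∃ i, (![0, 1, 2] : Fin 3 → Fin 4) i = l := fun l => by
    fin_cases l
    · exact Or.inr ⟨0, rfl⟩
    · exact Or.inr ⟨1, rfl⟩
    · exact Or.inr ⟨2, rfl⟩
    · exact Or.inl rfl
  obtain ⟨Ψ, ha, -, hs, hu⟩ := exists_rootModelEquiv_X e (![w 0, w 1, w 2, 0] : Fin 4 → ℕ) (![0, 1, 2] : Fin 3 → Fin 4) w hvW hW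
  rw [hfam]
  exact ⟨Ψ, ha, hs, fun i => by rw [hu i]; fin_cases i <;> rfl⟩

include hΨa in
/-- Pin on the variables: `Ψ(e⁻¹x_l) = x_none^{W l} · x′_l`. -/
theorem qh_model_X (l : Fin 4) : Ψ (algebraMap A _ (e.symm (X l))) = X none ^ (![w 0, w 1, w 2, 0] : Fin 4 → ℕ) l * X (some l) := by
  rw [hΨa, cobordantAlgebra.subst, MvPolynomial.eval₂Hom_X']

include hΨa hΨs in
/-- ★ **Tail pin**: `x_none^sh · Ψ t̂ = subst t`. -/
theorem qh_model_tail_pin : X none ^ sh * Ψ ⟨_, C_mul_T_mem_cobordantAlgebra _ _ ht⟩ = cobordantAlgebra.subst k (![w 0, w 1, w 2, 0] : Fin 4 → ℕ) t := by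
  have hRw : cobordantAlgebra.s (e.symm ∘ ![X 0, X 1, X 2] : Fin 3 → A) w ^ sh * ⟨_, C_mul_T_mem_cobordantAlgebra _ _ ht⟩ = algebraMap A _ (e.symm t) := by
    refine Subtype.ext ?_
    rw [MulMemClass.coe_mul, cobordantAlgebra.coe_s_pow, cobordantAlgebra.coe_algebraMap]
    change LaurentPolynomial.T (-((sh : ℕ) : ℤ)) * (LaurentPolynomial.C (e.symm t) * LaurentPolynomial.T ((sh : ℕ) : ℤ)) = _
    rw [mul_left_comm, ← LaurentPolynomial.T_add, neg_add_cancel, LaurentPolynomial.T_zero, mul_one]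
  rw [← hΨa, ← hRw, map_mul, map_pow, hΨs]

include hΨa hΨs in
/-- The tail in the model: `Ψ t̂ = T′` whenever `subst t = x_none^sh · T′`. -/
theorem qh_model_tail_eq (T' : MvPolynomial (Option (Fin 4)) k) (hT' : cobordantAlgebra.subst k (![w 0, w 1, w 2, 0] : Fin 4 → ℕ) t = X none ^ sh * T') :
    Ψ ⟨_, C_mul_T_mem_cobordantAlgebra _ _ ht⟩ = T' := by
  have h := qh_model_tail_pin w sh t e ht Ψ hΨa hΨs
  rw [hT'] at h
  exact mul_left_cancel₀ (pow_ne_zero _ (MvPolynomial.X_ne_zero none)) h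

include hact hC h0 h2 hΨa hΨs hΨu in
/-- `σ_P` FIXES `x_none`, `x′₀`, the invariant generator `x′₂` and the constants (one conjunction). -/
theorem qh_sigmaP_fixed :
    conj Ψ (sigmaR τ _ _ hσJ hp hσp) (X none) = X none ∧ conj Ψ (sigmaR τ _ _ hσJ hp hσp) (X (some 0)) = X (some 0) ∧
      conj Ψ (sigmaR τ _ _ hσJ hp hσp) (X (some 2)) = X (some 2) ∧ ∀ a : k, conj Ψ (sigmaR τ _ _ hσJ hp hσp) (C a) = C a := by
  refine ⟨?_, ?_, ?_, fun a => ?_⟩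
  · rw [← hΨs, conj_apply_map, sigmaR_s]
  · have hu := hΨu 0
    change Ψ _ = X (some 0) at hu
    rw [← hu, conj_apply_map, qh_sigmaR_u'_zero σ h0 w e τ hact hp hσp hσJ]
  · have hu := hΨu 2
    change Ψ _ = X (some 2) at hu
    rw [← hu, conj_apply_map, qh_sigmaR_u'_two σ h2 w e τ hact hp hσp hσJ]
  · have hc : Ψ (algebraMap A _ (e.symm (C a))) = C a := by
      rw [hΨa, cobordantAlgebra.subst, MvPolynomial.eval₂Hom_C]
    rw [← hc, conj_apply_map, sigmaR_algebraMap, A1.act_symm σ e τ hact, hC]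

include hact h1 hw0 hΨu hΨs in
/-- `σ_P x′₁ = x′₁ + x_none^sh · x′₀`. -/
theorem qh_sigmaP_X_some_one : conj Ψ (sigmaR τ _ _ hσJ hp hσp) (X (some 1)) = X (some 1) + X none ^ sh * X (some 0) := by
  have hu1 := hΨu 1
  have hu0 := hΨu 0
  change Ψ _ = X (some 1) at hu1
  change Ψ _ = X (some 0) at hu0
  have hu := congrArg (conj Ψ (sigmaR τ _ _ hσJ hp hσp)) hu1
  rw [← hu, conj_apply_map]
  have h := qh_sigmaR_u'_one_sub σ h1 w sh e τ hact hw0 hp hσp hσJ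
  rw [sub_eq_iff_eq_add] at h
  rw [h, map_add, map_mul, map_pow, hu1, hu0, hΨs, add_comm]

include hact h3 hΨa hΨs in
/-- `σ_P x₃ = x₃ + x_none^sh · Ψ t̂`. -/
theorem qh_sigmaP_X_some_three : conj Ψ (sigmaR τ _ _ hσJ hp hσp) (X (some 3)) = X (some 3) + X none ^ sh * Ψ ⟨_, C_mul_T_mem_cobordantAlgebra _ _ ht⟩ := by
  have hx3 : Ψ (algebraMap A _ (e.symm (X 3))) = X (some 3) := by rw [qh_model_X w e Ψ hΨa]; simp
  have hx := congrArg (conj Ψ (sigmaR τ _ _ hσJ hp hσp)) hx3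
  rw [← hx, conj_apply_map]
  have h := qh_sigmaR_algebraMap_three_sub σ w sh t h3 e τ hact ht hp hσp hσJ
  rw [sub_eq_iff_eq_add] at h
  rw [h, map_add, map_mul, map_pow, hx3, hΨs, add_comm]

/-! ## The free model of a producer chart -/

section Chart

variable {m : ℕ} (mo : Fin m → ℕ) (𝒜 : (Π j : Fin m, ZMod (mo j)) → AddSubgroup A) [GradedRing 𝒜]
  (hf : ∀ i, (e.symm ∘ ![X 0, X 1, X 2] : Fin 3 → A) i ∈ 𝒜 ((fun _ => (0 : Π j : Fin m, ZMod (mo j))) i))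
  (hx3 : e.symm (X 3) ∈ 𝒜 0) (ht0 : e.symm t ∈ 𝒜 0) (hC0 : ∀ c : k, e.symm (C c) ∈ 𝒜 0)
  {dbar : ℕ} (y : ↥(𝒜 0)) (hy : y ∈ (traceFiltration 𝒜 (e.symm ∘ ![X 0, X 1, X 2] : Fin 3 → A) w).ideal dbar) (hσy : τ (y : A) = y)

set_option maxHeartbeats 1600000 in
include hact hC h0 h2 hΨa hΨs hΨu in
/-- Rows: `τ′` FIXES `x_none`, `x′₀`, the invariant generator `x′₂`, `H⁻¹` and the constants (one conjunction). -/
theorem qh_model_rows_fixed :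
    conj (chartRingEquivAway 𝒜 _ _ dbar y hy Ψ) (sigmaChart 𝒜 _ _ dbar y hy τ hσJ hp hσp hσy) (algebraMap (MvPolynomial (Option (Fin 4)) k) (Localization.Away (Ψ (coverElement 𝒜 _ _ dbar y hy))) (X none)) = algebraMap (MvPolynomial (Option (Fin 4)) k) (Localization.Away (Ψ (coverElement 𝒜 _ _ dbar y hy))) (X none) ∧
    conj (chartRingEquivAway 𝒜 _ _ dbar y hy Ψ) (sigmaChart 𝒜 _ _ dbar y hy τ hσJ hp hσp hσy) (algebraMap (MvPolynomial (Option (Fin 4)) k) (Localization.Away (Ψ (coverElement 𝒜 _ _ dbar y hy))) (X (some 0))) = algebraMap (MvPolynomial (Option (Fin 4)) k) (Localization.Away (Ψ (coverElement 𝒜 _ _ dbar y hy))) (X (some 0)) ∧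
    conj (chartRingEquivAway 𝒜 _ _ dbar y hy Ψ) (sigmaChart 𝒜 _ _ dbar y hy τ hσJ hp hσp hσy) (algebraMap (MvPolynomial (Option (Fin 4)) k) (Localization.Away (Ψ (coverElement 𝒜 _ _ dbar y hy))) (X (some 2))) = algebraMap (MvPolynomial (Option (Fin 4)) k) (Localization.Away (Ψ (coverElement 𝒜 _ _ dbar y hy))) (X (some 2)) ∧
    ∀ g' ∈ (({IsLocalization.Away.invSelf (Ψ (coverElement 𝒜 _ _ dbar y hy))} : Set (Localization.Away (Ψ (coverElement 𝒜 _ _ dbar y hy)))) ∪ Set.range (algebraMap k (Localization.Away (Ψ (coverElement 𝒜 _ _ dbar y hy))))), conj (chartRingEquivAway 𝒜 _ _ dbar y hy Ψ) (sigmaChart 𝒜 _ _ dbar y hy τ hσJ hp hσp hσy) g' = g' := by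
  obtain ⟨fn, f0, f2, fC⟩ := qh_sigmaP_fixed σ hC h0 h2 w e τ hact hp hσp hσJ Ψ hΨa hΨs hΨu
  refine ⟨?_, ?_, ?_, ?_⟩
  · have h := modelSigma_apply_algebraMap mo 𝒜 _ _ dbar y hy τ hσJ hp hσp hσy Ψ (Ψ.symm (X none))
    rw [Ψ.apply_symm_apply] at h
    rw [h, ← conj_apply, fn]
  · have h := modelSigma_apply_algebraMap mo 𝒜 _ _ dbar y hy τ hσJ hp hσp hσy Ψ (Ψ.symm (X (some 0)))
    rw [Ψ.apply_symm_apply] at h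
    rw [h, ← conj_apply, f0]
  · have h := modelSigma_apply_algebraMap mo 𝒜 _ _ dbar y hy τ hσJ hp hσp hσy Ψ (Ψ.symm (X (some 2)))
    rw [Ψ.apply_symm_apply] at h
    rw [h, ← conj_apply, f2]
  · have key : ∀ g' ∈ (({IsLocalization.Away.invSelf (Ψ (coverElement 𝒜 _ _ dbar y hy))} : Set (Localization.Away (Ψ (coverElement 𝒜 _ _ dbar y hy)))) ∪
        Set.range (algebraMap k (Localization.Away (Ψ (coverElement 𝒜 _ _ dbar y hy))))),
        conj (chartRingEquivAway 𝒜 _ _ dbar y hy Ψ) (sigmaChart 𝒜 _ _ dbar y hy τ hσJ hp hσp hσy) g' = g' := by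
      rintro g' (hg | ⟨a, rfl⟩)
      · rw [Set.mem_singleton_iff.mp hg]
        exact modelSigma_invSelf mo 𝒜 _ _ dbar y hy τ hσJ hp hσp hσy Ψ
      · rw [IsScalarTower.algebraMap_apply k (MvPolynomial (Option (Fin 4)) k) (Localization.Away _) a, MvPolynomial.algebraMap_eq]
        have h := modelSigma_apply_algebraMap mo 𝒜 _ _ dbar y hy τ hσJ hp hσp hσy Ψ (Ψ.symm (C a))
        rw [Ψ.apply_symm_apply] at h
        rw [h, ← conj_apply, fC]
    exact key

include hact h1 hw0 hΨu hΨs in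
/-- Row: `τ′ x′₁ = x′₁ + x_none^sh · x′₀`. -/
theorem qh_model_row_one :
    conj (chartRingEquivAway 𝒜 _ _ dbar y hy Ψ) (sigmaChart 𝒜 _ _ dbar y hy τ hσJ hp hσp hσy)
        (algebraMap (MvPolynomial (Option (Fin 4)) k) (Localization.Away (Ψ (coverElement 𝒜 _ _ dbar y hy))) (X (some 1))) =
      algebraMap (MvPolynomial (Option (Fin 4)) k) (Localization.Away (Ψ (coverElement 𝒜 _ _ dbar y hy))) (X (some 1)) +
        algebraMap (MvPolynomial (Option (Fin 4)) k) (Localization.Away (Ψ (coverElement 𝒜 _ _ dbar y hy))) (X none) ^ sh *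
          algebraMap (MvPolynomial (Option (Fin 4)) k) (Localization.Away (Ψ (coverElement 𝒜 _ _ dbar y hy))) (X (some 0)) := by
  have h := modelSigma_apply_algebraMap mo 𝒜 _ _ dbar y hy τ hσJ hp hσp hσy Ψ (Ψ.symm (X (some 1)))
  rw [Ψ.apply_symm_apply] at h
  rw [h, ← conj_apply, qh_sigmaP_X_some_one σ h1 w sh e τ hact hw0 hp hσp hσJ Ψ hΨs hΨu, map_add, map_mul, map_pow]

include ht hact h3 hΨa hΨs in
/-- Row (general tail): `τ′ x₃ = x₃ + x_none^sh · T′` for any `T′` with `subst t = x_none^sh · T′`. -/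
theorem qh_model_row_three (T' : MvPolynomial (Option (Fin 4)) k) (hT' : cobordantAlgebra.subst k (![w 0, w 1, w 2, 0] : Fin 4 → ℕ) t = X none ^ sh * T') :
    conj (chartRingEquivAway 𝒜 _ _ dbar y hy Ψ) (sigmaChart 𝒜 _ _ dbar y hy τ hσJ hp hσp hσy)
        (algebraMap (MvPolynomial (Option (Fin 4)) k) (Localization.Away (Ψ (coverElement 𝒜 _ _ dbar y hy))) (X (some 3))) =
      algebraMap (MvPolynomial (Option (Fin 4)) k) (Localization.Away (Ψ (coverElement 𝒜 _ _ dbar y hy))) (X (some 3)) +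
        algebraMap (MvPolynomial (Option (Fin 4)) k) (Localization.Away (Ψ (coverElement 𝒜 _ _ dbar y hy))) (X none) ^ sh *
          algebraMap (MvPolynomial (Option (Fin 4)) k) (Localization.Away (Ψ (coverElement 𝒜 _ _ dbar y hy))) T' := by
  have h := modelSigma_apply_algebraMap mo 𝒜 _ _ dbar y hy τ hσJ hp hσp hσy Ψ (Ψ.symm (X (some 3)))
  rw [Ψ.apply_symm_apply] at h
  rw [h, ← conj_apply, qh_sigmaP_X_some_three σ w sh t h3 e τ hact ht hp hσp hσJ Ψ hΨa hΨs, qh_model_tail_eq w sh t e ht Ψ hΨa hΨs T' hT',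
    map_add, map_mul, map_pow]

include hact hC h0 h2 hΨa hΨs hΨu in
/-- `τ′` fixes the constants `C c` of the model. -/
theorem qh_model_row_C (c : k) :
    conj (chartRingEquivAway 𝒜 _ _ dbar y hy Ψ) (sigmaChart 𝒜 _ _ dbar y hy τ hσJ hp hσp hσy)
        (algebraMap (MvPolynomial (Option (Fin 4)) k) (Localization.Away (Ψ (coverElement 𝒜 _ _ dbar y hy))) (C c)) =
      algebraMap (MvPolynomial (Option (Fin 4)) k) (Localization.Away (Ψ (coverElement 𝒜 _ _ dbar y hy))) (C c) := by
  have h := (qh_model_rows_fixed σ hC h0 h2 w e τ hact hp hσp hσJ Ψ hΨa hΨs hΨu mo 𝒜 y hy hσy).2.2.2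
    (algebraMap k (Localization.Away (Ψ (coverElement 𝒜 _ _ dbar y hy))) c) (Set.mem_union_right _ ⟨c, rfl⟩)
  rwa [IsScalarTower.algebraMap_apply k (MvPolynomial (Option (Fin 4)) k) (Localization.Away (Ψ (coverElement 𝒜 _ _ dbar y hy))) c, MvPolynomial.algebraMap_eq] at h

/-! ### Degrees relative to `θ = consIndexEquiv mo (1, 0)` -/
include hf hΨu in
/-- `x′ᵢ` has degree `(w i) • θ` (`i = 0, 1, 2`). -/
theorem qh_model_degree_u' (i : Fin 3) :
    letI := chartNodeGradedRing mo 𝒜 (e.symm ∘ ![X 0, X 1, X 2] : Fin 3 → A) w hf dbar y hy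
    algebraMap (MvPolynomial (Option (Fin 4)) k) (Localization.Away (Ψ (coverElement 𝒜 _ _ dbar y hy))) (X (some (Fin.castSucc i))) ∈
      mapGrading (chartNodeGrading mo 𝒜 (e.symm ∘ ![X 0, X 1, X 2] : Fin 3 → A) w hf dbar y hy) (chartRingEquivAway 𝒜 _ _ dbar y hy Ψ)
        ((w i) • consIndexEquiv mo ((1 : ℤ), (0 : Π j : Fin m, ZMod (mo j)))) := by
  letI := chartNodeGradedRing mo 𝒜 (e.symm ∘ ![X 0, X 1, X 2] : Fin 3 → A) w hf dbar y hy
  have h := algebraMap_mem_mapGrading_chartNode mo 𝒜 (e.symm ∘ ![X 0, X 1, X 2] : Fin 3 → A) w hf dbar y hy Ψ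
    (u'_mem_reesPiece 𝒜 (e.symm ∘ ![X 0, X 1, X 2] : Fin 3 → A) (δ := fun _ => 0) w hf i)
  rw [hΨu i] at h
  have hidx : consIndexEquiv mo ((((w i : ℕ)) : ℤ), (fun _ : Fin 3 => (0 : Π j : Fin m, ZMod (mo j))) i) =
      (w i) • consIndexEquiv mo ((1 : ℤ), (0 : Π j : Fin m, ZMod (mo j))) := consIndexEquiv_nat_zero mo (w i)
  rw [hidx] at h
  exact h

include hx3 hΨa in
/-- `x₃` has degree `0`. -/
theorem qh_model_degree_three :
    letI := chartNodeGradedRing mo 𝒜 (e.symm ∘ ![X 0, X 1, X 2] : Fin 3 → A) w hf dbar y hy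
    algebraMap (MvPolynomial (Option (Fin 4)) k) (Localization.Away (Ψ (coverElement 𝒜 _ _ dbar y hy))) (X (some 3)) ∈
      mapGrading (chartNodeGrading mo 𝒜 (e.symm ∘ ![X 0, X 1, X 2] : Fin 3 → A) w hf dbar y hy) (chartRingEquivAway 𝒜 _ _ dbar y hy Ψ) 0 := by
  letI := chartNodeGradedRing mo 𝒜 (e.symm ∘ ![X 0, X 1, X 2] : Fin 3 → A) w hf dbar y hy
  have h := algebraMap_mem_mapGrading_chartNode mo 𝒜 (e.symm ∘ ![X 0, X 1, X 2] : Fin 3 → A) w hf dbar y hy Ψ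
    (algebraMap_mem_reesPiece 𝒜 (e.symm ∘ ![X 0, X 1, X 2] : Fin 3 → A) w hx3)
  have hx3 : Ψ (algebraMap A _ (e.symm (X 3))) = X (some 3) := by rw [qh_model_X w e Ψ hΨa]; simp
  rw [hx3, Prod.mk_zero_zero, map_zero] at h
  exact h

include hC0 hΨa in
/-- Constants have degree `0`. -/
theorem qh_model_degree_C (c : k) :
    letI := chartNodeGradedRing mo 𝒜 (e.symm ∘ ![X 0, X 1, X 2] : Fin 3 → A) w hf dbar y hy
    algebraMap (MvPolynomial (Option (Fin 4)) k) (Localization.Away (Ψ (coverElement 𝒜 _ _ dbar y hy))) (C c) ∈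
      mapGrading (chartNodeGrading mo 𝒜 (e.symm ∘ ![X 0, X 1, X 2] : Fin 3 → A) w hf dbar y hy) (chartRingEquivAway 𝒜 _ _ dbar y hy Ψ) 0 := by
  letI := chartNodeGradedRing mo 𝒜 (e.symm ∘ ![X 0, X 1, X 2] : Fin 3 → A) w hf dbar y hy
  have h := algebraMap_mem_mapGrading_chartNode mo 𝒜 (e.symm ∘ ![X 0, X 1, X 2] : Fin 3 → A) w hf dbar y hy Ψ
    (algebraMap_mem_reesPiece 𝒜 (e.symm ∘ ![X 0, X 1, X 2] : Fin 3 → A) w (hC0 c))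
  have hc : Ψ (algebraMap A _ (e.symm (C c))) = C c := by rw [hΨa, cobordantAlgebra.subst, MvPolynomial.eval₂Hom_C]
  rw [hc, Prod.mk_zero_zero, map_zero] at h
  exact h

include ht0 in
/-- `Ψ t̂` has degree `sh • θ`. -/
theorem qh_model_degree_tail :
    letI := chartNodeGradedRing mo 𝒜 (e.symm ∘ ![X 0, X 1, X 2] : Fin 3 → A) w hf dbar y hy
    algebraMap (MvPolynomial (Option (Fin 4)) k) (Localization.Away (Ψ (coverElement 𝒜 _ _ dbar y hy))) (Ψ ⟨_, C_mul_T_mem_cobordantAlgebra _ _ ht⟩) ∈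
      mapGrading (chartNodeGrading mo 𝒜 (e.symm ∘ ![X 0, X 1, X 2] : Fin 3 → A) w hf dbar y hy) (chartRingEquivAway 𝒜 _ _ dbar y hy Ψ)
        (sh • consIndexEquiv mo ((1 : ℤ), (0 : Π j : Fin m, ZMod (mo j)))) := by
  letI := chartNodeGradedRing mo 𝒜 (e.symm ∘ ![X 0, X 1, X 2] : Fin 3 → A) w hf dbar y hy
  have h := algebraMap_mem_mapGrading_chartNode mo 𝒜 (e.symm ∘ ![X 0, X 1, X 2] : Fin 3 → A) w hf dbar y hy Ψ
    (mk_mem_reesPiece 𝒜 (e.symm ∘ ![X 0, X 1, X 2] : Fin 3 → A) w ht0 (C_mul_T_mem_cobordantAlgebra _ _ ht))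
  rw [consIndexEquiv_nat_zero mo sh] at h
  exact h

include hf hΨs in
/-- `x_none = s` has degree `−θ`. -/
theorem qh_model_degree_none :
    letI := chartNodeGradedRing mo 𝒜 (e.symm ∘ ![X 0, X 1, X 2] : Fin 3 → A) w hf dbar y hy
    algebraMap (MvPolynomial (Option (Fin 4)) k) (Localization.Away (Ψ (coverElement 𝒜 _ _ dbar y hy))) (X none) ∈
      mapGrading (chartNodeGrading mo 𝒜 (e.symm ∘ ![X 0, X 1, X 2] : Fin 3 → A) w hf dbar y hy) (chartRingEquivAway 𝒜 _ _ dbar y hy Ψ)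
        (-(consIndexEquiv mo ((1 : ℤ), (0 : Π j : Fin m, ZMod (mo j))))) := by
  letI := chartNodeGradedRing mo 𝒜 (e.symm ∘ ![X 0, X 1, X 2] : Fin 3 → A) w hf dbar y hy
  have h := algebraMap_mem_mapGrading_chartNode mo 𝒜 (e.symm ∘ ![X 0, X 1, X 2] : Fin 3 → A) w hf dbar y hy Ψ
    (s_mem_reesPiece 𝒜 (e.symm ∘ ![X 0, X 1, X 2] : Fin 3 → A) w)
  rw [hΨs] at h
  have hidx : consIndexEquiv mo ((-1 : ℤ), (0 : Π j : Fin m, ZMod (mo j))) = -(consIndexEquiv mo ((1 : ℤ), (0 : Π j : Fin m, ZMod (mo j)))) := by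
    rw [consIndexEquiv_int_zero mo (-1), neg_one_zsmul]
  rw [hidx] at h
  exact h

include hf in
/-- `H⁻¹` has degree `−(dbar • θ)`. -/
theorem qh_model_degree_invSelf :
    letI := chartNodeGradedRing mo 𝒜 (e.symm ∘ ![X 0, X 1, X 2] : Fin 3 → A) w hf dbar y hy
    IsLocalization.Away.invSelf (Ψ (coverElement 𝒜 _ _ dbar y hy)) ∈
      mapGrading (chartNodeGrading mo 𝒜 (e.symm ∘ ![X 0, X 1, X 2] : Fin 3 → A) w hf dbar y hy) (chartRingEquivAway 𝒜 _ _ dbar y hy Ψ)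
        (-(dbar • (consIndexEquiv mo ((1 : ℤ), (0 : Π j : Fin m, ZMod (mo j)))))) := by
  letI := chartNodeGradedRing mo 𝒜 (e.symm ∘ ![X 0, X 1, X 2] : Fin 3 → A) w hf dbar y hy
  have h := invSelf_mem_mapGrading_chartNode mo 𝒜 (e.symm ∘ ![X 0, X 1, X 2] : Fin 3 → A) w hf dbar y hy Ψ
  have hidx : consIndexEquiv mo (-(dbar : ℤ), (0 : Π j : Fin m, ZMod (mo j))) = -(dbar • (consIndexEquiv mo ((1 : ℤ), (0 : Π j : Fin m, ZMod (mo j))))) := by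
    rw [consIndexEquiv_int_zero mo, neg_zsmul, natCast_zsmul]
  rw [hidx] at h
  exact h

/-! ### Residual-section pin -/
include hΨu in
/-- Pin: `Φ(u₀′ⁿ · c⁻¹) = x′₀ⁿ · H⁻¹`. -/
theorem qh_model_residual_zero (n : ℕ) :
    chartRingEquivAway 𝒜 _ _ dbar y hy Ψ (algebraMap _ (ChartRing 𝒜 (e.symm ∘ ![X 0, X 1, X 2] : Fin 3 → A) w dbar y hy)
        (cobordantAlgebra.u' (e.symm ∘ ![X 0, X 1, X 2] : Fin 3 → A) w 0 ^ n) * IsLocalization.Away.invSelf (coverElement 𝒜 _ _ dbar y hy)) =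
      algebraMap (MvPolynomial (Option (Fin 4)) k) (Localization.Away (Ψ (coverElement 𝒜 _ _ dbar y hy))) (X (some 0)) ^ n *
        IsLocalization.Away.invSelf (Ψ (coverElement 𝒜 _ _ dbar y hy)) := by
  have hu0 := hΨu 0
  change Ψ _ = X (some 0) at hu0
  rw [chartRingEquivAway_algebraMap_mul_invSelf, map_pow, hu0, map_pow]

end Chart

end Summit.ResolutionOfSingularities.ResolutionOfSingularities.Theorems.WildQuotientResolution.S1.KillCert.Qh

end
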